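import Summits.CriticalPhenomena.PercolationContinuityZ3.Theorems.PercGamblersRuinVerticalGamblersRuinStubGoodPlateOfNoDrift

/-!
# Route `PercGamblersRuin`, crux `VerticalGamblersRuin` (stmt-CriticalPhenomena-10642):
# stub `stub_nestedShiftComparison` — nested-slab comparison after a shift

Helper file for the stub `stub_nestedShiftComparison` of the line `registered` (skeleton rev 7,
the deterministic-time criterion) of the crux `PercGamblersRuin.VerticalGamblersRuin`.

Setting: bond configurations `ω` on `ℤ³` (`Site 3 = Fin 3 → ℤ`, height coordinate `x 0`);
`N_ω(x) = ((zdGraph 3).neighborFinset x).filter (fun y => s(x, y) ∈ ω)` is the set of lattice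
neighbours of `x` joined to `x` by an open edge; the configuration seen from `x` is
`ω - x = BondConfig.relabel (sym2Equiv (Site.shift (-x))) ω`.  For `K, n ≥ 1`:

* `v` is (for every `ω`) a *voltage of the big slab* `S = (-Kn, (K+1)n)`: values in `[0, 1]`,
  `= 1` on `{(K+1)n ≤ x₀}`, `= 0` on `{x₀ ≤ -Kn}`, harmonic for the open lattice edges of `ω` at
  every site of `{-Kn < x₀ < (K+1)n}`;
* `w` enjoys the superharmonic minimality of the minimal voltage of the *lopsided slab*
  `S' = (-(K+1)n, Kn)`: `w ω ≤ f` for every `f ≥ 0` with `f ≥ 1` on `{Kn ≤ x₀}` and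
  `∑_{y ∈ N_ω(x)} (f y - f x) ≤ 0` at every site of `{-(K+1)n < x₀ < Kn}`.

Statement proved (exact registered signature): `w(ω - x, 0) ≤ v(ω, x)` for every site `x` with
`n ≤ x₀` (pathwise: a walk from `x` that reaches height `x₀ + Kn ≥ (K+1)n` before height
`x₀ - (K+1)n ≥ -Kn` has reached `{(K+1)n ≤ x₀'}` before `{x₀' ≤ -Kn}`).

Proof.  Fix `ω`, `x` with `n ≤ x₀` and apply the minimality of `w` at `ω' := ω - x` to the test
function `f := z ↦ v(ω, z + x)`: (i) `f ≥ 0`; (ii) for `Kn ≤ z₀`, `(z + x)₀ ≥ Kn + n = (K+1)n`, so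
`f z = 1`; (iii) for `-(K+1)n < z₀ < Kn` the defect `∑_{y ∈ N_{ω'}(z)} (f y - f z)` is the defect of
`v(ω, ·)` at `z + x` for the configuration `ω' + x = ω` (`StubGoodPlateOfNoDrift.defect_shift` and
`(ω - x) + x = ω`); there `(z + x)₀ > -(K+1)n + n = -Kn`, so the defect vanishes if
`(z + x)₀ < (K+1)n` (harmonicity of `v`) and is `≤ 0` if `(z + x)₀ ≥ (K+1)n` (`v(ω, z + x) = 1` and
`v ≤ 1` at the neighbours); (iv) hence `w(ω', 0) ≤ f 0 = v(ω, x)`.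

## References

* R. Lyons, Y. Peres, *Probability on Trees and Networks*, Cambridge University Press (2016),
  §2.1 (voltages; minimality of the equilibrium potential among nonnegative supersolutions).
* G. Grimmett, *Percolation*, 2nd ed., Springer (1999), §1.6 (translations of configurations).
-/

noncomputable section

namespace Summit.CriticalPhenomena.PercolationContinuityZ3.Theorems.VerticalGamblersRuin

open MeasureTheory Filter Topology
open Literature.Probability.Percolation Literature.Probability.LatticeModels
open scoped Classical

namespace StubNestedShiftComparison

/-- **Defects seen from a site.** The harmonicity defect at `z` of `y ↦ f (y + x)` for the open
lattice edges of `ω - x` is the defect at `z + x` of `f` for the open lattice edges of `ω`: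
`StubGoodPlateOfNoDrift.defect_shift` turns it into the defect of `f` at `z + x` for `(ω - x) + x`,
and `(ω - x) + x = ω` (edgewise, `s(a, b) = s(a - x + x, b - x + x)` is open in `(ω - x) + x` iff
`s(a - x, b - x)` is open in `ω - x` iff `s(a, b)` is open in `ω`, `mk_add_mem_relabel_shift_iff`
twice; this folklore identity is also recorded in the tree as
`FloorNoFloor.relabel_shift_relabel_shift_neg`, whose module is not imported here to keep the
import closure of the `VerticalGamblersRuin` files small). -/
theorem defect_seen_from (x : Site 3) (ω : BondConfig (Site 3)) (f : Site 3 → ℝ) (z : Site 3) :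
    ∑ y ∈ ((zdGraph 3).neighborFinset z).filter
        (fun y => s(z, y) ∈ BondConfig.relabel (sym2Equiv (Site.shift (-x))) ω),
          (f (y + x) - f (z + x)) =
      ∑ y ∈ ((zdGraph 3).neighborFinset (z + x)).filter (fun y => s(z + x, y) ∈ ω),
        (f y - f (z + x)) := by
  have hcomp : BondConfig.relabel (sym2Equiv (Site.shift x))
      (BondConfig.relabel (sym2Equiv (Site.shift (-x))) ω) = ω := by
    ext e
    induction e using Sym2.ind with
    | h a b =>
      have h1 := mk_add_mem_relabel_shift_iff x
        (BondConfig.relabel (sym2Equiv (Site.shift (-x))) ω) (a + -x) (b + -x)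
      rw [neg_add_cancel_right, neg_add_cancel_right] at h1
      exact h1.trans (mk_add_mem_relabel_shift_iff (-x) ω a b)
  rw [StubGoodPlateOfNoDrift.defect_shift, hcomp]

/-- **The shifted big-slab voltage is an admissible test function for the lopsided minimality.**
Let `g : ℤ³ → [0, 1]` be `= 1` on `{(K+1)n ≤ y₀}` and harmonic for the open lattice edges of `ω`
on `{-Kn < y₀ < (K+1)n}`, and let `n ≤ x₀`.  Then `z ↦ g (z + x)` is nonnegative, `≥ 1` on
`{Kn ≤ z₀}` (there `(z + x)₀ ≥ (K+1)n`), and superharmonic for the open lattice edges of `ω - x`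
on `{-(K+1)n < z₀ < Kn}`: by `defect_seen_from` its defect at `z` is the defect of `g` at `z + x`
for `ω`, where `(z + x)₀ > -Kn`; this vanishes if `(z + x)₀ < (K+1)n` and is `≤ 0` otherwise
(`g (z + x) = 1 ≥ g` at the neighbours). -/
theorem shifted_test {K n : ℕ} {x : Site 3} (hx : (n : ℤ) ≤ x 0) {ω : BondConfig (Site 3)}
    {g : Site 3 → ℝ} (hb : ∀ y, 0 ≤ g y ∧ g y ≤ 1)
    (htop : ∀ y : Site 3, (((K + 1) * n : ℕ) : ℤ) ≤ y 0 → g y = 1)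
    (hharm : ∀ y : Site 3, -((K * n : ℕ) : ℤ) < y 0 → y 0 < (((K + 1) * n : ℕ) : ℤ) →
      ∑ z ∈ ((zdGraph 3).neighborFinset y).filter (fun z => s(y, z) ∈ ω), (g z - g y) = 0) :
    (∀ z, 0 ≤ g (z + x)) ∧
      (∀ z : Site 3, ((K * n : ℕ) : ℤ) ≤ z 0 → 1 ≤ g (z + x)) ∧
      ∀ z : Site 3, -(((K + 1) * n : ℕ) : ℤ) < z 0 → z 0 < ((K * n : ℕ) : ℤ) →
        ∑ y ∈ ((zdGraph 3).neighborFinset z).filter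
            (fun y => s(z, y) ∈ BondConfig.relabel (sym2Equiv (Site.shift (-x))) ω),
          (g (y + x) - g (z + x)) ≤ 0 := by
  have h0 : ∀ z : Site 3, (z + x) 0 = z 0 + x 0 := fun z => rfl
  refine ⟨fun z => (hb (z + x)).1, fun z hz => ?_, fun z hz _ => ?_⟩
  · rw [htop (z + x) (by rw [h0]; push_cast at hz ⊢; linarith)]
  · rw [defect_seen_from]
    have hlow : -((K * n : ℕ) : ℤ) < (z + x) 0 := by
      rw [h0]; push_cast at hz ⊢; linarith
    rcases lt_or_ge ((z + x) 0) (((K + 1) * n : ℕ) : ℤ) with hlt | hge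
    · exact (hharm (z + x) hlow hlt).le
    · refine Finset.sum_nonpos fun y _ => ?_
      rw [htop (z + x) hge]
      linarith [(hb y).2]

end StubNestedShiftComparison

open StubNestedShiftComparison in
/-- **Stub `stub_nestedShiftComparison`** of the crux `VerticalGamblersRuin` (line `registered`,
rev 7; exact registered signature): **a big-slab voltage dominates, at every site of height `≥ n`,
the minimal voltage of the lopsided slab seen from that site.**  For `K, n ≥ 1`, every `v` that is
for every `ω` a voltage of the slab `(-Kn, (K+1)n)` (values in `[0, 1]`, `= 1` on
`{(K+1)n ≤ x₀}`, `= 0` on `{x₀ ≤ -Kn}`, harmonic for the open lattice edges of `ω` in between) and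
every `w` with the superharmonic minimality property of the minimal voltage of the lopsided slab
`(-(K+1)n, Kn)` (`w ω ≤ f` for every `f ≥ 0` that is `≥ 1` on `{Kn ≤ x₀}` and superharmonic for
the open lattice edges of `ω` on `{-(K+1)n < x₀ < Kn}`): `w(ω - x, 0) ≤ v(ω, x)` whenever
`n ≤ x₀`.  Proof: apply the minimality of `w` at `ω - x` to the admissible test function
`z ↦ v(ω, z + x)` (`StubNestedShiftComparison.shifted_test`) and evaluate at `z = 0`. -/
theorem stub_nestedShiftComparison :
    ∀ (K n : ℕ), 0 < K → 0 < n →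
      ∀ v : BondConfig (Site 3) → Site 3 → ℝ,
        (∀ ω, (∀ x, 0 ≤ v ω x ∧ v ω x ≤ 1) ∧
          (∀ x : Site 3, (((K + 1) * n : ℕ) : ℤ) ≤ x 0 → v ω x = 1) ∧
          (∀ x : Site 3, x 0 ≤ -((K * n : ℕ) : ℤ) → v ω x = 0) ∧
          ∀ x : Site 3, -((K * n : ℕ) : ℤ) < x 0 → x 0 < (((K + 1) * n : ℕ) : ℤ) →
            ∑ y ∈ ((zdGraph 3).neighborFinset x).filter (fun y => s(x, y) ∈ ω), (v ω y - v ω x) = 0) →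
      ∀ w : BondConfig (Site 3) → Site 3 → ℝ,
        (∀ (ω : BondConfig (Site 3)) (f : Site 3 → ℝ), (∀ x, 0 ≤ f x) →
          (∀ x : Site 3, ((K * n : ℕ) : ℤ) ≤ x 0 → 1 ≤ f x) →
          (∀ x : Site 3, -(((K + 1) * n : ℕ) : ℤ) < x 0 → x 0 < ((K * n : ℕ) : ℤ) →
            ∑ y ∈ ((zdGraph 3).neighborFinset x).filter (fun y => s(x, y) ∈ ω), (f y - f x) ≤ 0) →
          ∀ x, w ω x ≤ f x) →
      ∀ (ω : BondConfig (Site 3)) (x : Site 3), (n : ℤ) ≤ x 0 →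
        w (BondConfig.relabel (sym2Equiv (Site.shift (-x))) ω) 0 ≤ v ω x := by
  intro K n _ _ v hv w hw ω x hx
  obtain ⟨h1, h2, h3⟩ := shifted_test (K := K) hx (hv ω).1 (hv ω).2.1 (hv ω).2.2.2
  have h : w (BondConfig.relabel (sym2Equiv (Site.shift (-x))) ω) 0 ≤ v ω (0 + x) :=
    hw _ (fun z => v ω (z + x)) h1 h2 h3 0
  rwa [zero_add] at h

end Summit.CriticalPhenomena.PercolationContinuityZ3.Theorems.VerticalGamblersRuin
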